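import Literature.NumberTheory.PAdicHodge.BdRPlusLogLatticeZp
import HarnessLib

/-!
# Series of logarithmic type `Σ_{m≥1} (b_m/m) ι(y)^m`, `b_m ∈ ℤ_p`, evaluated `p`-ADICALLY modulo `Fil^k B_dR⁺` — e.g. formal-group logarithms `log_W(ι[ũ])`

Topic `Literature/NumberTheory/PAdicHodge`; namespace `Literature.NumberTheory.PAdicHodge.GaloisContinuity`. Definitions (reviewed): `logTypeTerm`,
`logTypePartialSum`, `IsLogTypeModFil`. This file GENERALISES `BdRPlusLogLattice` (LEAD edix-p1 g20: the case `b_m = (−1)^{m+1}`, i.e. `log(1+y)`)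
and §1 of `BdRPlusLogLatticeZp` / `BdRPlusLogLatticeTheta` §1–2 (this seat) from the logarithm to an ARBITRARY series of logarithmic type
`ℓ_b(y) = Σ_{m≥1} (b_m/m) y^m` with `p`-adically integral numerators `b : ℕ → ℤ_p` — the shape of every one-dimensional formal-group logarithm
over `ℤ_(p)` (`log_W(z) = Σ (d_m/m) z^m`, `d_m ∈ ℤ[a₁,…,a₆]`), hence of Fontaine's integrating element `log_W(ι[ũ])` of the Kummer cocycle of a point
of `Ŵ` (tree `AinfWeierstrassKummerIntegral`: «does NOT converge ξ-adically … differs from b_ω by the constant log_ω(P), which re-enters only in the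
explicit reciprocity law»). For `y ∈ (p, ξ)𝔸_inf` and every `k`:

* §1 `logTypeTerm_mem_lattice` (`(b_n/n) ι(y)ⁿ ∈ Λ(n − k − v_p(n), k)`), `logTypePartialSum_sub_mem_lattice` (lattice-Cauchy);
* §2 `IsLogTypeModFil b k y L` and ★ `exists_isLogTypeModFil` (existence, completeness of `B_dR⁺/Fil^k`), ★ `IsLogTypeModFil.sub_mem_span_xiBdR_pow`
  (uniqueness mod `ξ^k`), `IsLogTypeModFil.galBdRPlus` (`Γ_F`-equivariance), `IsLogTypeModFil.of_sub_mem`;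
* §3 ★ `logTypePartialSum_sub_logTypePartialSum_mem_lattice` (`p`-adic continuity in `y`, uniformly in `M`) and ★ `IsLogTypeModFil.of_approx`;
* §4 `isLogTypeModFil_iff_isLogModFil` — for `b_m = (−1)^{m+1}` this IS `IsLogModFil` (so `BdRPlusLogLattice*` are the special case).

Additivity along a formal group law `G` with `ℓ_b(G(X,Y)) = ℓ_b(X) + ℓ_b(Y)` and `θ`-compatibility are the sequels (the `log(1+y)` case is
`BdRPlusLogLatticeMul` / `BdRPlusLogLatticeTheta`). Line `kato_lever` of crux K★ `stmt-BirchSwinnertonDyer-22226`, floor (H4) step (3) (the `p`-adic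
evaluation layer for `[Q̃]`); infrastructure only — BSD / K★ are not proved by any of this.

## References
* J.-M. Fontaine, *Le corps des périodes p-adiques*, Astérisque 223 (1994), Exp. II §1.5.3–1.5.4. [FontaineAsterisque223III]
* J.-M. Fontaine, *Formes différentielles et modules de Tate des variétés abéliennes sur les corps locaux*, Invent. Math. 65 (1982), §5. [Fontaine1982FormesDifferentielles]
-/

noncomputable section

open ValuativeRel Field Ideal WittVector

namespace Literature.NumberTheory.PAdicHodge

namespace GaloisContinuity

open Literature.NumberTheory.GaloisRepresentations
open Literature.NumberTheory.GaloisRepresentations.IsNonarchimedeanLocalField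
open Finset

variable {F : Type} [Field F] [ValuativeRel F] [TopologicalSpace F] [IsNonarchimedeanLocalField F]
  [CharZero F] {p : ℕ} [Fact p.Prime] [Fact (¬ IsUnit (p : integerC F))]
  [IsAdicComplete (Ideal.span {(p : integerC F)}) (integerC F)]

/-! ## §1 Terms and partial sums of a series of logarithmic type -/

/-- **The `n`-th term `(b_n/n) ι(y)ⁿ ∈ B_dR⁺`** of the logarithmic-type series with numerators `b : ℕ → ℤ_p` at `y ∈ 𝔸_inf` (junk `0` at `n = 0`).
[cite: Fontaine1982FormesDifferentielles, §5] -/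
def logTypeTerm (b : ℕ → ℤ_[p]) (y : Ainf (p := p) F) (n : ℕ) : BDeRhamPlus (integerC F) p :=
  qpToBdR (((b n : ℤ_[p]) : ℚ_[p]) / (n : ℚ_[p])) * ainfToBdR y ^ n

/-- **The partial sum `P^b_N(y) = Σ_{n=1}^{N} (b_n/n) ι(y)ⁿ`.** [cite: Fontaine1982FormesDifferentielles, §5] -/
def logTypePartialSum (b : ℕ → ℤ_[p]) (y : Ainf (p := p) F) (N : ℕ) : BDeRhamPlus (integerC F) p :=
  ∑ n ∈ Finset.range N, logTypeTerm b y (n + 1)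

omit [CharZero F] in
/-- `P^b_{N+1} = P^b_N + (N+1)`-st term. [cite: Fontaine1982FormesDifferentielles, §5] -/
theorem logTypePartialSum_succ (b : ℕ → ℤ_[p]) (y : Ainf (p := p) F) (N : ℕ) :
    logTypePartialSum b y (N + 1) = logTypePartialSum b y N + logTypeTerm b y (N + 1) := by
  rw [logTypePartialSum, Finset.sum_range_succ, logTypePartialSum]

omit [CharZero F] [Fact (¬ IsUnit (p : integerC F))] [IsAdicComplete (Ideal.span {(p : integerC F)}) (integerC F)]
  [ValuativeRel F] [TopologicalSpace F] [IsNonarchimedeanLocalField F] [Fact p.Prime] in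
/-- `v_q(n) ≤ n/2`: `q^e ∣ n ≠ 0 ⇒ e + e ≤ n` (`q ≥ 2`). [folklore] -/
private theorem add_self_le_of_pow_dvd' {q e n : ℕ} (hq : 2 ≤ q) (hn : n ≠ 0) (h : q ^ e ∣ n) : e + e ≤ n := by
  have h2 : ∀ m : ℕ, m + m ≤ 2 ^ m := fun m => by
    induction m with
    | zero => simp
    | succ m ih => have hm : 1 ≤ 2 ^ m := Nat.one_le_two_pow; rw [pow_succ]; omega
  exact (h2 e).trans ((Nat.pow_le_pow_left hq e).trans (Nat.le_of_dvd (Nat.pos_of_ne_zero hn) h))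

omit [CharZero F] in
/-- ★ **`logTypeTerm b y n ∈ Λ(n − k − e, k)`** for `y ∈ (p, ξ)`, `n = p^e n'`, `p ∤ n'`, `k + e ≤ n`: the numerator `b_n ∈ ℤ_p` costs nothing, the
denominator `n` costs `p^{−e}`, against `(p,ξ)ⁿ ⊆ p^{n−k}𝔸_inf + ξ^k𝔸_inf`. [cite: FontaineAsterisque223III, Exp. II §1.5.3] -/
theorem logTypeTerm_mem_lattice (b : ℕ → ℤ_[p]) {y : Ainf (p := p) F} (hy : y ∈ Ideal.span {(p : Ainf (p := p) F), xi})
    {n k e n' : ℕ} (hn : n = p ^ e * n') (hn' : ¬ p ∣ n') (hke : k + e ≤ n) :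
    ∃ (a : Ainf (p := p) F) (w : BDeRhamPlus (integerC F) p),
      logTypeTerm b y n = ainfToBdR ((p : Ainf (p := p) F) ^ (n - k - e) * a) + xiBdR ^ k * w := by
  obtain ⟨c₁, c₂, hbc⟩ := exists_pow_eq_of_mem_span_p_xi hy (show k ≤ n by omega)
  obtain ⟨v, hv⟩ := isUnit_natCast_padicInt_of_not_dvd (p := p) hn'
  set g : ℤ_[p] := b n * ↑v⁻¹ with hg
  have hp0 : (p : ℚ_[p]) ≠ 0 := Nat.cast_ne_zero.2 (Fact.out : p.Prime).ne_zero
  have hcoef : ((b n : ℤ_[p]) : ℚ_[p]) / (n : ℚ_[p]) * (p : ℚ_[p]) ^ (n - k) = (g : ℚ_[p]) * (p : ℚ_[p]) ^ (n - k - e) := by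
    have hvv : ((v : ℤ_[p]) : ℚ_[p]) * ((↑v⁻¹ : ℤ_[p]) : ℚ_[p]) = 1 := by
      rw [← PadicInt.coe_mul, Units.mul_inv, PadicInt.coe_one]
    have hA0 : ((v : ℤ_[p]) : ℚ_[p]) ≠ 0 := fun h0 => by rw [h0, zero_mul] at hvv; exact zero_ne_one hvv
    have hB : (((v⁻¹ : ℤ_[p]ˣ) : ℤ_[p]) : ℚ_[p]) = (((v : ℤ_[p]) : ℚ_[p]))⁻¹ := eq_inv_of_mul_eq_one_right hvv
    have hsplit : (p : ℚ_[p]) ^ (n - k) = (p : ℚ_[p]) ^ e * (p : ℚ_[p]) ^ (n - k - e) := by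
      rw [← pow_add]; congr 1; omega
    have hn1 : (n : ℚ_[p]) = (p : ℚ_[p]) ^ e * ((v : ℤ_[p]) : ℚ_[p]) := by rw [hn, hv]; push_cast; rfl
    rw [hsplit, hg, PadicInt.coe_mul, hB, hn1]
    field_simp
  refine ⟨zpToAinf g * c₁, qpToBdR (((b n : ℤ_[p]) : ℚ_[p]) / (n : ℚ_[p])) * ainfToBdR c₂, ?_⟩
  have hq : qpToBdR (((b n : ℤ_[p]) : ℚ_[p]) / (n : ℚ_[p])) * (p : BDeRhamPlus (integerC F) p) ^ (n - k) =
      ainfToBdR ((p : Ainf (p := p) F) ^ (n - k - e) * zpToAinf g) := by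
    rw [← map_natCast (qpToBdR (F := F) (p := p)) p, ← map_pow, ← map_mul, hcoef, map_mul, map_pow, map_natCast, qpToBdR_coe]
    simp only [map_mul, map_pow, map_natCast]
    ring
  rw [logTypeTerm, ← map_pow, hbc, map_add, map_mul, map_mul, map_pow, map_natCast, map_pow, ainfToBdR_xi, mul_add, ← mul_assoc, hq]
  simp only [map_mul, map_pow, map_natCast]
  ring

omit [CharZero F] in
/-- Each term beyond `2(j + k)` lies in `Λ(j, k)`. [cite: FontaineAsterisque223III, Exp. II §1.5.3] -/
theorem logTypeTerm_mem_lattice_of_lt (b : ℕ → ℤ_[p]) {y : Ainf (p := p) F} (hy : y ∈ Ideal.span {(p : Ainf (p := p) F), xi})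
    {j k n : ℕ} (hn : 2 * (j + k) < n) :
    ∃ (a : Ainf (p := p) F) (w : BDeRhamPlus (integerC F) p),
      logTypeTerm b y n = ainfToBdR ((p : Ainf (p := p) F) ^ j * a) + xiBdR ^ k * w := by
  have hn0 : n ≠ 0 := by omega
  obtain ⟨e, n', hn', hne⟩ := Nat.exists_eq_pow_mul_and_not_dvd hn0 p (Fact.out : p.Prime).one_lt.ne'
  have he : e + e ≤ n := add_self_le_of_pow_dvd' (Fact.out : p.Prime).two_le hn0 ⟨n', hne⟩
  obtain ⟨a, w, h⟩ := logTypeTerm_mem_lattice b (k := k) hy hne hn' (by omega)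
  exact lattice_mono (show j ≤ n - k - e by omega) le_rfl h

omit [CharZero F] in
/-- ★ **The partial sums are lattice-Cauchy**: `P^b_N(y) − P^b_M(y) ∈ Λ(j, k)` for `2(j+k) ≤ M ≤ N`. [cite: FontaineAsterisque223III, Exp. II §1.5.3] -/
theorem logTypePartialSum_sub_mem_lattice (b : ℕ → ℤ_[p]) {y : Ainf (p := p) F} (hy : y ∈ Ideal.span {(p : Ainf (p := p) F), xi})
    {j k M N : ℕ} (hM : 2 * (j + k) ≤ M) (hMN : M ≤ N) :
    ∃ (a : Ainf (p := p) F) (w : BDeRhamPlus (integerC F) p),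
      logTypePartialSum b y N - logTypePartialSum b y M = ainfToBdR ((p : Ainf (p := p) F) ^ j * a) + xiBdR ^ k * w := by
  induction N, hMN using Nat.le_induction with
  | base => exact ⟨0, 0, by simp⟩
  | succ N hMN ih =>
    obtain ⟨a, w, h⟩ := ih
    obtain ⟨a', w', h'⟩ := logTypeTerm_mem_lattice_of_lt b hy (j := j) (k := k) (n := N + 1) (by omega)
    refine ⟨a + a', w + w', ?_⟩
    rw [logTypePartialSum_succ, show logTypePartialSum b y N + logTypeTerm b y (N + 1) - logTypePartialSum b y M =
      (logTypePartialSum b y N - logTypePartialSum b y M) + logTypeTerm b y (N + 1) by ring]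
    exact lattice_add h h'

/-! ## §2 `ℓ_b(y)` modulo `Fil^k`: existence, uniqueness, `Γ_F`-equivariance -/

/-- **`L` is a value of `ℓ_b(y) = Σ (b_m/m) ι(y)^m` modulo `Fil^k`**: `P^b_M(y) → L` for Fontaine's `p`-adic topology on `B_dR⁺/Fil^k` (for every `j`,
`L − P^b_M(y) ∈ Λ(j, k)` for `M ≫ 0`). [cite: FontaineAsterisque223III, Exp. II §1.5.4] [cite: Fontaine1982FormesDifferentielles, §5] -/
def IsLogTypeModFil (b : ℕ → ℤ_[p]) (k : ℕ) (y : Ainf (p := p) F) (L : BDeRhamPlus (integerC F) p) : Prop :=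
  ∀ j : ℕ, ∃ M₀ : ℕ, ∀ M : ℕ, M₀ ≤ M → ∃ (a : Ainf (p := p) F) (w : BDeRhamPlus (integerC F) p),
    L - logTypePartialSum b y M = ainfToBdR ((p : Ainf (p := p) F) ^ j * a) + xiBdR ^ k * w

/-- ★ **Existence**: for `y ∈ (p, ξ)` and every `k` the series `ℓ_b(y)` has a value modulo `Fil^k` (completeness of `B_dR⁺/Fil^k`).
[cite: FontaineAsterisque223III, Exp. II §1.5.3–1.5.4] -/
theorem exists_isLogTypeModFil (b : ℕ → ℤ_[p]) {y : Ainf (p := p) F} (hy : y ∈ Ideal.span {(p : Ainf (p := p) F), xi}) (k : ℕ) :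
    ∃ L : BDeRhamPlus (integerC F) p, IsLogTypeModFil b k y L := by
  obtain ⟨L, r, hL⟩ := exists_lim_of_forall_sub_mem_lattice (x := fun j => logTypePartialSum b y (2 * (j + k))) (k := k)
    (fun N => logTypePartialSum_sub_mem_lattice b hy le_rfl (by omega))
  refine ⟨L, fun j => ⟨2 * (j + r + k), fun M hM => ?_⟩⟩
  obtain ⟨a, w, h1⟩ := hL j (j + r) le_rfl
  obtain ⟨a', w', h2⟩ := logTypePartialSum_sub_mem_lattice b hy (j := j + r) (k := k) (le_refl (2 * (j + r + k))) hM
  obtain ⟨a'', w'', h3⟩ := lattice_mono (show j ≤ j + r by omega) le_rfl h2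
  refine ⟨a - a'', w - w'', ?_⟩
  have e : L - logTypePartialSum b y M = (L - logTypePartialSum b y (2 * (j + r + k))) -
      (logTypePartialSum b y M - logTypePartialSum b y (2 * (j + r + k))) := by ring
  rw [e]
  exact lattice_sub h1 h3

/-- ★ **Uniqueness modulo `Fil^k`.** [cite: FontaineAsterisque223III, Exp. II §1.5.3] -/
theorem IsLogTypeModFil.sub_mem_span_xiBdR_pow {b : ℕ → ℤ_[p]} {k : ℕ} {y : Ainf (p := p) F} {L L' : BDeRhamPlus (integerC F) p}
    (hL : IsLogTypeModFil b k y L) (hL' : IsLogTypeModFil b k y L') :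
    L - L' ∈ Ideal.span {(xiBdR : BDeRhamPlus (integerC F) p) ^ k} := by
  refine sub_mem_span_xiBdR_pow_of_forall_lattice_lim (x := logTypePartialSum b y) fun N => ?_
  obtain ⟨M₀, h⟩ := hL N
  obtain ⟨M₀', h'⟩ := hL' N
  obtain ⟨a, w, h1⟩ := h (max M₀ M₀') (le_max_left _ _)
  obtain ⟨a', w', h2⟩ := h' (max M₀ M₀') (le_max_right _ _)
  exact ⟨max M₀ M₀', a, w, h1, a', w', h2⟩

omit [CharZero F] in
/-- Invariance modulo `Fil^k`. [cite: FontaineAsterisque223III, Exp. II §1.5.3] -/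
theorem IsLogTypeModFil.of_sub_mem {b : ℕ → ℤ_[p]} {k : ℕ} {y : Ainf (p := p) F} {L L' : BDeRhamPlus (integerC F) p}
    (hL : IsLogTypeModFil b k y L) (h : L' - L ∈ Ideal.span {(xiBdR : BDeRhamPlus (integerC F) p) ^ k}) : IsLogTypeModFil b k y L' := by
  obtain ⟨c, hc⟩ := Ideal.mem_span_singleton'.1 h
  intro j
  obtain ⟨M₀, hM₀⟩ := hL j
  refine ⟨M₀, fun M hM => ?_⟩
  obtain ⟨a, w, h1⟩ := hM₀ M hM
  refine ⟨a, w + c, ?_⟩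
  have e : L' - logTypePartialSum b y M = (L - logTypePartialSum b y M) + (L' - L) := by ring
  rw [e, h1, ← hc]; ring

omit [CharZero F] in
/-- `σ(P^b_N(y)) = P^b_N(σ y)` (the numerators `b_m ∈ ℤ_p` are `Γ_F`-fixed). [cite: FontaineAsterisque223III, Exp. II §1.5.4] -/
theorem galBdRPlus_logTypePartialSum [CharZero F] (σ : absoluteGaloisGroup F) (b : ℕ → ℤ_[p]) (y : Ainf (p := p) F) (N : ℕ) :
    galBdRPlus σ (logTypePartialSum b y N) = logTypePartialSum b (galAinf σ y) N := by
  simp only [logTypePartialSum, logTypeTerm, map_sum, map_mul, map_pow, galBdRPlus_qpToBdR, galBdRPlus_ainfToBdR]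

/-- **`Γ_F`-equivariance**: `σ L` is a value of `ℓ_b(σ y)` modulo `Fil^k`. [cite: FontaineAsterisque223III, Exp. II §1.5.4] -/
theorem IsLogTypeModFil.galBdRPlus {b : ℕ → ℤ_[p]} {k : ℕ} {y : Ainf (p := p) F} {L : BDeRhamPlus (integerC F) p}
    (hL : IsLogTypeModFil b k y L) (σ : absoluteGaloisGroup F) : IsLogTypeModFil b k (galAinf σ y) (galBdRPlus σ L) := by
  intro j
  obtain ⟨M₀, h⟩ := hL j
  refine ⟨M₀, fun M hM => ?_⟩
  obtain ⟨a, w, h1⟩ := h M hM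
  obtain ⟨w', hw'⟩ := exists_galBdRPlus_xiBdR_pow_mul σ k w
  refine ⟨galAinf σ a, w', ?_⟩
  rw [← galBdRPlus_logTypePartialSum, ← map_sub, h1, map_add, galBdRPlus_ainfToBdR, hw', map_mul, map_pow, map_natCast]

/-! ## §3 `p`-adic continuity in the argument and closedness under approximation -/

/-- `yⁿ − y'ⁿ ∈ I^{N + (n − 1)}` for `y, y' ∈ I`, `y − y' ∈ I^N`. [folklore] -/
private theorem pow_sub_pow_mem_pow' {R : Type*} [CommRing R] {I : Ideal R} {y y' : R} (hy : y ∈ I) (hy' : y' ∈ I) {N : ℕ}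
    (h : y - y' ∈ I ^ N) (n : ℕ) : y ^ n - y' ^ n ∈ I ^ (N + (n - 1)) := by
  rw [← geom_sum₂_mul, add_comm, pow_add]
  refine Ideal.mul_mem_mul (Ideal.sum_mem _ fun i hi => ?_) h
  have hi' := Finset.mem_range.1 hi
  have e : I ^ (n - 1) = I ^ i * I ^ (n - 1 - i) := by rw [← pow_add]; congr 1; omega
  rw [e]
  exact Ideal.mul_mem_mul (Ideal.pow_mem_pow hy _) (Ideal.pow_mem_pow hy' _)

omit [CharZero F] in
/-- `(b_{m+1}/(m+1)) · ι(w) ∈ Λ(j, k)` for `w ∈ (p, ξ)^{M+1}`, `m < M`, `2(j+k) ≤ M`. [cite: FontaineAsterisque223III, Exp. II §1.5.3] -/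
theorem coeff_mul_ainfToBdR_mem_lattice (b : ℕ → ℤ_[p]) {j k M m : ℕ} (hM : 2 * (j + k) ≤ M) (hm : m < M)
    {w : Ainf (p := p) F} (hw : w ∈ Ideal.span {(p : Ainf (p := p) F), xi} ^ (M + 1)) :
    ∃ (a : Ainf (p := p) F) (v : BDeRhamPlus (integerC F) p),
      qpToBdR (((b (m + 1) : ℤ_[p]) : ℚ_[p]) / ((m + 1 : ℕ) : ℚ_[p])) * ainfToBdR w =
        ainfToBdR ((p : Ainf (p := p) F) ^ j * a) + xiBdR ^ k * v := by
  -- the same computation as `logTypeTerm_mem_lattice`, with `w` in place of `y^{m+1}`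
  obtain ⟨e, n', hn', hne⟩ := Nat.exists_eq_pow_mul_and_not_dvd (Nat.add_one_ne_zero m) p (Fact.out : p.Prime).one_lt.ne'
  have he : e + e ≤ m + 1 := add_self_le_of_pow_dvd' (Fact.out : p.Prime).two_le (Nat.add_one_ne_zero m) ⟨n', hne⟩
  obtain ⟨c₁, c₂, hbc⟩ := exists_eq_of_mem_span_p_xi_pow (show k ≤ M + 1 by omega) hw
  obtain ⟨v, hv⟩ := isUnit_natCast_padicInt_of_not_dvd (p := p) hn'
  set g : ℤ_[p] := b (m + 1) * ↑v⁻¹ with hg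
  have hp0 : (p : ℚ_[p]) ≠ 0 := Nat.cast_ne_zero.2 (Fact.out : p.Prime).ne_zero
  have hcoef : ((b (m + 1) : ℤ_[p]) : ℚ_[p]) / ((m + 1 : ℕ) : ℚ_[p]) * (p : ℚ_[p]) ^ (M + 1 - k) =
      (g : ℚ_[p]) * (p : ℚ_[p]) ^ (M + 1 - k - e) := by
    have hvv : ((v : ℤ_[p]) : ℚ_[p]) * ((↑v⁻¹ : ℤ_[p]) : ℚ_[p]) = 1 := by
      rw [← PadicInt.coe_mul, Units.mul_inv, PadicInt.coe_one]
    have hA0 : ((v : ℤ_[p]) : ℚ_[p]) ≠ 0 := fun h0 => by rw [h0, zero_mul] at hvv; exact zero_ne_one hvv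
    have hB : (((v⁻¹ : ℤ_[p]ˣ) : ℤ_[p]) : ℚ_[p]) = (((v : ℤ_[p]) : ℚ_[p]))⁻¹ := eq_inv_of_mul_eq_one_right hvv
    have hsplit : (p : ℚ_[p]) ^ (M + 1 - k) = (p : ℚ_[p]) ^ e * (p : ℚ_[p]) ^ (M + 1 - k - e) := by
      rw [← pow_add]; congr 1; omega
    have hn1 : ((m + 1 : ℕ) : ℚ_[p]) = (p : ℚ_[p]) ^ e * ((v : ℤ_[p]) : ℚ_[p]) := by
      rw [hv, PadicInt.coe_natCast]; exact_mod_cast hne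
    rw [hsplit, hg, PadicInt.coe_mul, hB, hn1]
    field_simp
  refine lattice_mono (show j ≤ M + 1 - k - e by omega) le_rfl (a := zpToAinf g * c₁)
    (w := qpToBdR (((b (m + 1) : ℤ_[p]) : ℚ_[p]) / ((m + 1 : ℕ) : ℚ_[p])) * ainfToBdR c₂) ?_
  have hq : qpToBdR (((b (m + 1) : ℤ_[p]) : ℚ_[p]) / ((m + 1 : ℕ) : ℚ_[p])) * (p : BDeRhamPlus (integerC F) p) ^ (M + 1 - k) =
      ainfToBdR ((p : Ainf (p := p) F) ^ (M + 1 - k - e) * zpToAinf g) := by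
    rw [← map_natCast (qpToBdR (F := F) (p := p)) p, ← map_pow, ← map_mul, hcoef, map_mul, map_pow, map_natCast, qpToBdR_coe]
    simp only [map_mul, map_pow, map_natCast]
    ring
  rw [hbc, map_add, map_mul, map_mul, map_pow, map_natCast, map_pow, ainfToBdR_xi, mul_add, ← mul_assoc, hq]
  simp only [map_mul, map_pow, map_natCast]
  ring

omit [CharZero F] in
/-- ★ **`P^b_M` is `p`-adically continuous in `y`, uniformly in `M`**: `y − y' ∈ (p,ξ)^N`, `N ≥ 2(j+k)+2` ⟹ `P^b_M(y) − P^b_M(y') ∈ Λ(j, k)`.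
[cite: FontaineAsterisque223III, Exp. II §1.5.3] -/
theorem logTypePartialSum_sub_logTypePartialSum_mem_lattice (b : ℕ → ℤ_[p]) {y y' : Ainf (p := p) F}
    (hy : y ∈ Ideal.span {(p : Ainf (p := p) F), xi}) (hy' : y' ∈ Ideal.span {(p : Ainf (p := p) F), xi}) {j k N : ℕ}
    (hN : 2 * (j + k) + 2 ≤ N) (h : y - y' ∈ Ideal.span {(p : Ainf (p := p) F), xi} ^ N) (M : ℕ) :
    ∃ (a : Ainf (p := p) F) (w : BDeRhamPlus (integerC F) p),
      logTypePartialSum b y M - logTypePartialSum b y' M = ainfToBdR ((p : Ainf (p := p) F) ^ j * a) + xiBdR ^ k * w := by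
  rw [logTypePartialSum, logTypePartialSum, ← Finset.sum_sub_distrib]
  refine lattice_sum _ fun m hm => ?_
  rw [logTypeTerm, logTypeTerm, ← mul_sub, ← map_pow, ← map_pow, ← map_sub, Nat.cast_add, Nat.cast_one,
    show ((m : ℚ_[p]) + 1) = ((m + 1 : ℕ) : ℚ_[p]) by push_cast; rfl]
  have hw : y ^ (m + 1) - y' ^ (m + 1) ∈ Ideal.span {(p : Ainf (p := p) F), xi} ^ ((m + 2 * (j + k) + 1) + 1) :=
    Ideal.pow_le_pow_right (by omega) (pow_sub_pow_mem_pow' hy hy' h (m + 1))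
  exact coeff_mul_ainfToBdR_mem_lattice b (by omega) (by omega) hw

omit [CharZero F] in
/-- ★ **`IsLogTypeModFil` is closed under `p`-adic approximation** of argument and value. [cite: FontaineAsterisque223III, Exp. II §1.5.3] -/
theorem IsLogTypeModFil.of_approx {b : ℕ → ℤ_[p]} {k : ℕ} {y : Ainf (p := p) F} (hy : y ∈ Ideal.span {(p : Ainf (p := p) F), xi})
    {L : BDeRhamPlus (integerC F) p}
    (h : ∀ j : ℕ, ∃ (y' : Ainf (p := p) F) (L' : BDeRhamPlus (integerC F) p), y' ∈ Ideal.span {(p : Ainf (p := p) F), xi} ∧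
      IsLogTypeModFil b k y' L' ∧ y' - y ∈ Ideal.span {(p : Ainf (p := p) F), xi} ^ (2 * (j + k) + 2) ∧
      ∃ (a : Ainf (p := p) F) (w : BDeRhamPlus (integerC F) p), L' - L = ainfToBdR ((p : Ainf (p := p) F) ^ j * a) + xiBdR ^ k * w) :
    IsLogTypeModFil b k y L := by
  intro j
  obtain ⟨y', L', hy', hL', hyy', a, w, hLL'⟩ := h j
  obtain ⟨M₀, hM₀⟩ := hL' j
  refine ⟨M₀, fun M hM => ?_⟩
  obtain ⟨a₁, w₁, h1⟩ := hM₀ M hM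
  obtain ⟨a₂, w₂, h2⟩ := logTypePartialSum_sub_logTypePartialSum_mem_lattice b hy' hy le_rfl hyy' M
  refine ⟨a₁ - a + a₂, w₁ - w + w₂, ?_⟩
  have e : L - logTypePartialSum b y M = (L' - logTypePartialSum b y' M) - (L' - L) +
      (logTypePartialSum b y' M - logTypePartialSum b y M) := by ring
  rw [e]
  exact lattice_add (lattice_sub h1 hLL') h2

/-! ## §4 The logarithm is the case `b_m = (−1)^{m+1}` -/

omit [CharZero F] in
/-- `logTerm` is `logTypeTerm` for `b_m = (−1)^{m+1}`. [cite: FontaineAsterisque223III, Exp. II §1.5.4] -/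
theorem logTypeTerm_neg_one_pow (y : Ainf (p := p) F) (n : ℕ) :
    logTypeTerm (fun m => (-1 : ℤ_[p]) ^ (m + 1)) y n = logTerm y n := by
  rw [logTypeTerm, logTerm, PadicInt.coe_pow, PadicInt.coe_neg, PadicInt.coe_one]

omit [CharZero F] in
/-- `logPartialSum` is `logTypePartialSum` for `b_m = (−1)^{m+1}`. [cite: FontaineAsterisque223III, Exp. II §1.5.4] -/
theorem logTypePartialSum_neg_one_pow (y : Ainf (p := p) F) (N : ℕ) :
    logTypePartialSum (fun m => (-1 : ℤ_[p]) ^ (m + 1)) y N = logPartialSum y N := by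
  simp only [logTypePartialSum, logPartialSum, logTypeTerm_neg_one_pow]

omit [CharZero F] in
/-- **`IsLogModFil` is `IsLogTypeModFil` for `b_m = (−1)^{m+1}`**: the tree's logarithm files are the special case.
[cite: FontaineAsterisque223III, Exp. II §1.5.4] -/
theorem isLogTypeModFil_neg_one_pow_iff {k : ℕ} {y : Ainf (p := p) F} {L : BDeRhamPlus (integerC F) p} :
    IsLogTypeModFil (fun m => (-1 : ℤ_[p]) ^ (m + 1)) k y L ↔ IsLogModFil k y L := by
  simp only [IsLogTypeModFil, IsLogModFil, logTypePartialSum_neg_one_pow]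

end GaloisContinuity

end Literature.NumberTheory.PAdicHodge

end
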